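import Mathlib
import HarnessLib
import Summits.HubbardSuperconductivity.HubbardSuperconductivity.Theorems.KLProgrammeKLRegimeVolumeLimitTannery
import Summits.HubbardSuperconductivity.HubbardSuperconductivity.Theorems.KLProgrammeKLRegimeTwoPointAssemblyIntTools

/-!
# Route `KLProgramme` — crux K3, child «VolumeLimit» (`VolumeLimitP2 klPreds… FinalTwoLegVolLimit klWindowC`):
# the POSITION-SPACE DOOR into the volume-limit text `FinalTwoLegVolLimit β U μ K Mstar`
# (cell gate-hubbard-kl, seat hubbard-kl-r2d-p2 g2 — the consumer side of the VL slot; `--supports` the VolumeLimit child)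

WHY.  The VL text of record (`FinalTwoLegVolLimit`, p448970) is stated on the MOMENTUM grid: a uniform bound and, per Matsubara
integer, convergence of `Σ̂_{L,M}(ω, k⃗, σ)` uniformly on the torus momentum grid to a momentum-CONTINUOUS limit.  The tree's bridge
from the engine's termwise data to that text (`volLimit_of_termwise`, hubbard-kl-k3c4-p1) asks every TERM to converge on the grid to a
continuous limit.  A fermionic cluster / tree expansion, however, exports its two-leg kernel most naturally in POSITION space:
`Σ̂_{L,M}(ω, k⃗, σ) = Σ_z χ_z(p_{k⃗}) · S_{L,M}(ω; z, σ)` — a sum over RELATIVE SITES `z ∈ ℤ²` (torus kernel lifted to the centred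
fundamental domain, zero outside) against bounded continuous characters `χ_z` (`e^{∓ip·z}`) — with
  (a) a DECAY MAJORANT `‖S_{L,M}(ω; z, σ)‖ ≤ m(z)`, `Σ_z m(z) < ∞`, UNIFORM in the volume `(L, M)` and in the frequency `ω` (the
      space–time `L¹` norm of the kernel, which is what Gram–Hadamard × sector counting bounds: BGM 2006 (2.77), [BM2001] §2.3 fn. 1
      «bounds uniform in L»; Feldman–Magnen–Rivasseau–Trubowitz 1992, Thm 1: single-scale bounds «independent of j and Λ»), and
  (b) TERMWISE SITE LIMITS: for every Matsubara integer `n` and every site `z`, `S_{L,M}(ω_n; z, σ) → S_∞(n; z, σ)` eventually in `L`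
      and then in `M` (FMRT 1992, Thm 1: «the limits … exist»; BGM 2006 §2.4 (2.38)).
From (a) + (b) ALONE the momentum text follows — no momentum-space continuity or grid interpolation is ever needed: the limit
`Σ∞(n, p, σ) := Σ_z χ_z(p) S_∞(n; z, σ)` is continuous by absolute convergence (Weierstrass), the uniform bound is `B = Σ_z m(z)`, and
grid convergence is Tannery's theorem over the `L`-INDEPENDENT index set `ℤ²` (the point of the position representation: the summation
domain does not move with the volume, only the summands do).  Formally this is the instance `ι := Site 2` of `volLimit_of_termwise`
with terms `v_z = χ_z(p_{k⃗}) · S_{L,M}(ω; z, σ)`; the bound on the site limits `‖S_∞(n; z, σ)‖ ≤ m(z)` is DERIVED from (a) + (b)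
(`norm_siteLimit_le`), so the door's hypotheses are exactly (a), (b) and the representation.

* `norm_siteLimit_le` — (a) + (b) ⇒ `‖S_∞(n; z, σ)‖ ≤ m(z)`;
* `volLimit_of_siteKernel` — ABSTRACT form for any grid family `S L M : FreqMomentum L M → Fin 2 → ℂ` and any bounded continuous
  characters `χ_z`: position representation + (a) + (b) ⇒ the three clauses of the VL text for `S`;
* `finalTwoLegVolLimit_of_siteKernel` — the instance `S = klSelfEnergy … (nScales β + 1)`: **position-space data ⇒
  `FinalTwoLegVolLimit β U μ K Mstar`**;
* `volLimit_of_siteKernel_freq` / `finalTwoLegVolLimit_of_siteKernel_freq` — the same with a decay majorant `m n z` allowed to depend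
  on the external Matsubara integer `n` (`Σ_z m n z ≤ B` for every `n`), the shape multi-loop terms meet (`volLimit_of_termwise_freq`).

Pure bookkeeping over the k3c4-p1 Tannery bridge; nothing is asserted about the model.  References: J. Feldman, J. Magnen, V. Rivasseau,
E. Trubowitz, Helv. Phys. Acta 65 (1992) 679–721, Thm 1; G. Benfatto, A. Giuliani, V. Mastropietro, Ann. Henri Poincaré 7 (2006)
809–898, §2.3 fn. 1, §2.4 (2.38), (2.77).
-/

noncomputable section

namespace Summit.HubbardSuperconductivity.HubbardSuperconductivity.Theorems.KLRegimeSplit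

set_option linter.dupNamespace false -- summit = problem name (single-conjunct summit), D-0017

open Filter Topology Finset Literature.MathematicalPhysics.QuantumLattice Literature.Probability.LatticeModels
open Summit.HubbardSuperconductivity.HubbardSuperconductivity.Theorems.KLProgrammeLegKernels
open Summit.HubbardSuperconductivity.HubbardSuperconductivity.Theorems.TwoPointAssembly

/-! ## §1 The site limits inherit the decay majorant -/

/-- **(a) + (b) ⇒ the site limits obey the same majorant.**  If a volume-indexed site family `Spos L M ω z σ` is bounded by `m z`
beyond thresholds `(L₀, Mstar)` at every frequency label, and converges at the Matsubara integer `n` and site `z` (eventually in `L`,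
then in `M`) to `SposInf n z σ`, then `‖SposInf n z σ‖ ≤ m z`. -/
theorem norm_siteLimit_le
    {Spos : ∀ (L M : ℕ) [NeZero L] [NeZero M], MatsubaraIdx M → Site 2 → Fin 2 → ℂ}
    {SposInf : ℤ → Site 2 → Fin 2 → ℂ} {m : Site 2 → ℝ} {Mstar : ℕ → ℕ} {L₀ : ℕ}
    (hmaj : ∀ (z : Site 2) (L : ℕ) [NeZero L], L₀ ≤ L → ∀ (M : ℕ) [NeZero M], Mstar L ≤ M →
      ∀ (ω : MatsubaraIdx M) (σ : Fin 2), ‖Spos L M ω z σ‖ ≤ m z)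
    (hlim : ∀ (n : ℤ) (σ : Fin 2) (z : Site 2) (ε : ℝ), 0 < ε → ∃ L₁ : ℕ, ∀ (L : ℕ) [NeZero L], L₁ ≤ L →
      ∃ M₁ : ℕ, ∀ (M : ℕ) [NeZero M], M₁ ≤ M → ∀ ω : MatsubaraIdx M, matsubaraInt M ω = n →
        ‖Spos L M ω z σ - SposInf n z σ‖ ≤ ε)
    (n : ℤ) (z : Site 2) (σ : Fin 2) : ‖SposInf n z σ‖ ≤ m z := by
  refine le_of_forall_pos_le_add fun ε hε => ?_
  obtain ⟨L₁, hL₁⟩ := hlim n σ z ε hε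
  -- a volume beyond both thresholds
  set L : ℕ := max (max L₀ L₁) 1 with hL
  haveI : NeZero L := ⟨by omega⟩
  have hL0 : L₀ ≤ L := (le_max_left _ _).trans (le_max_left _ _)
  have hL1 : L₁ ≤ L := (le_max_right _ _).trans (le_max_left _ _)
  obtain ⟨M₁, hM₁⟩ := hL₁ L hL1
  -- a Matsubara cutoff beyond both thresholds that carries the integer `n`
  set M : ℕ := max (max (Mstar L) M₁) (n.natAbs + 1) with hM
  haveI : NeZero M := ⟨by omega⟩
  have hMs : Mstar L ≤ M := (le_max_left _ _).trans (le_max_left _ _)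
  have hM1 : M₁ ≤ M := (le_max_right _ _).trans (le_max_left _ _)
  have hMn : n.natAbs + 1 ≤ M := le_max_right _ _
  have hn : -(M : ℤ) ≤ n ∧ n < M := by omega
  set ω : MatsubaraIdx M := idxOfInt M n hn
  have hω : matsubaraInt M ω = n := matsubaraInt_idxOfInt M n hn
  have h1 : ‖Spos L M ω z σ‖ ≤ m z := hmaj z L hL0 M hMs ω σ
  have h2 : ‖Spos L M ω z σ - SposInf n z σ‖ ≤ ε := hM₁ M hM1 ω hω
  calc ‖SposInf n z σ‖ = ‖Spos L M ω z σ - (Spos L M ω z σ - SposInf n z σ)‖ := by rw [sub_sub_cancel]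
    _ ≤ ‖Spos L M ω z σ‖ + ‖Spos L M ω z σ - SposInf n z σ‖ := norm_sub_le _ _
    _ ≤ m z + ε := add_le_add h1 h2

/-! ## §2 The position-space door (abstract form) -/

/-- **Position-space data ⇒ the volume-limit text (abstract form).**  Let `S L M : FreqMomentum L M → Fin 2 → ℂ` be a volume-indexed
grid family which, beyond thresholds `(L₀, Mstar)`, is represented as a site series `S L M (ω, k⃗) σ = Σ_z χ_z(p_{k⃗}) · Spos L M ω z σ`
against bounded continuous characters `χ_z` (`‖χ_z(p)‖ ≤ 1`; e.g. `e^{∓ip·z}`), with (a) a summable decay majorant `‖Spos L M ω z σ‖ ≤ m z`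
uniform in `(L, M, ω)` and (b) per Matsubara integer `n` and site `z`, convergence of `Spos L M ω_n z σ` (eventually in `L`, then in
`M`) to `SposInf n z σ`.  Then `S` is bounded by `Σ'_z m z` beyond `(L₀, Mstar)` and converges on the grid, per Matsubara integer and
uniformly on the momentum grid, to the CONTINUOUS function `Σ∞ n p σ = Σ'_z χ_z(p) · SposInf n z σ`. -/
theorem volLimit_of_siteKernel
    {S : ∀ (L M : ℕ) [NeZero L] [NeZero M], FreqMomentum L M → Fin 2 → ℂ} {Mstar : ℕ → ℕ}
    {χ : Site 2 → (Fin 2 → ℝ) → ℂ} (hχc : ∀ z, Continuous (χ z)) (hχ1 : ∀ z p, ‖χ z p‖ ≤ 1)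
    {Spos : ∀ (L M : ℕ) [NeZero L] [NeZero M], MatsubaraIdx M → Site 2 → Fin 2 → ℂ}
    {SposInf : ℤ → Site 2 → Fin 2 → ℂ} {m : Site 2 → ℝ} (hm : Summable m) {L₀ : ℕ}
    (hrepr : ∀ (L : ℕ) [NeZero L], L₀ ≤ L → ∀ (M : ℕ) [NeZero M], Mstar L ≤ M →
      ∀ (ω : MatsubaraIdx M) (k : TorusSite 2 L) (σ : Fin 2),
        HasSum (fun z => χ z (latticeMomentum L k) * Spos L M ω z σ) (S L M (ω, k) σ))
    (hmaj : ∀ (z : Site 2) (L : ℕ) [NeZero L], L₀ ≤ L → ∀ (M : ℕ) [NeZero M], Mstar L ≤ M →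
      ∀ (ω : MatsubaraIdx M) (σ : Fin 2), ‖Spos L M ω z σ‖ ≤ m z)
    (hlim : ∀ (n : ℤ) (σ : Fin 2) (z : Site 2) (ε : ℝ), 0 < ε → ∃ L₁ : ℕ, ∀ (L : ℕ) [NeZero L], L₁ ≤ L →
      ∃ M₁ : ℕ, ∀ (M : ℕ) [NeZero M], M₁ ≤ M → ∀ ω : MatsubaraIdx M, matsubaraInt M ω = n →
        ‖Spos L M ω z σ - SposInf n z σ‖ ≤ ε) :
    ∃ sigmaInf : ℤ → (Fin 2 → ℝ) → Fin 2 → ℂ, ∃ B : ℝ, ∃ L₀' : ℕ,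
      (∀ (n : ℤ) (σ : Fin 2), Continuous fun p : Fin 2 → ℝ => sigmaInf n p σ) ∧
      (∀ (L : ℕ) [NeZero L], L₀' ≤ L → ∀ (M : ℕ) [NeZero M], Mstar L ≤ M →
        ∀ (k : FreqMomentum L M) (σ : Fin 2), ‖S L M k σ‖ ≤ B) ∧
      (∀ (n : ℤ) (σ : Fin 2) (ε : ℝ), 0 < ε → ∃ L₁ : ℕ, ∀ (L : ℕ) [NeZero L], L₁ ≤ L →
        ∃ M₁ : ℕ, ∀ (M : ℕ) [NeZero M], M₁ ≤ M → ∀ ω : MatsubaraIdx M, matsubaraInt M ω = n →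
          ∀ k : TorusSite 2 L, ‖S L M (ω, k) σ - sigmaInf n (latticeMomentum L k) σ‖ ≤ ε) := by
  have hbddInf : ∀ (n : ℤ) (z : Site 2) (σ : Fin 2), ‖SposInf n z σ‖ ≤ m z :=
    norm_siteLimit_le (Mstar := Mstar) hmaj hlim
  have hmul : ∀ (z : Site 2) (p : Fin 2 → ℝ) (a : ℂ), ‖χ z p * a‖ ≤ ‖a‖ := fun z p a => by
    rw [norm_mul]
    exact (mul_le_of_le_one_left (norm_nonneg a) (hχ1 z p))
  refine volLimit_of_termwise (S := S) (Mstar := Mstar) (ι := Site 2)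
    (v := fun z L M _ _ k σ => χ z (latticeMomentum L k.2) * Spos L M k.1 z σ)
    (vInf := fun z n p σ => χ z p * SposInf n z σ) (m := m) hm (L₀ := L₀) ?_ ?_ ?_ ?_ ?_
  · intro L _ hL M _ hM k σ
    obtain ⟨ω, kk⟩ := k
    exact hrepr L hL M hM ω kk σ
  · intro z L _ hL M _ hM k σ
    exact (hmul z _ _).trans (hmaj z L hL M hM k.1 σ)
  · intro z n σ
    exact (hχc z).mul continuous_const
  · intro z n p σ
    exact (hmul z p _).trans (hbddInf n z σ)
  · intro z n σ ε hε
    obtain ⟨L₁, hL₁⟩ := hlim n σ z ε hε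
    refine ⟨L₁, fun L _ hL => ?_⟩
    obtain ⟨M₁, hM₁⟩ := hL₁ L hL
    refine ⟨M₁, fun M _ hM ω hω k => ?_⟩
    have h := hM₁ M hM ω hω
    calc ‖χ z (latticeMomentum L k) * Spos L M ω z σ - χ z (latticeMomentum L k) * SposInf n z σ‖
        = ‖χ z (latticeMomentum L k) * (Spos L M ω z σ - SposInf n z σ)‖ := by rw [mul_sub]
      _ ≤ ‖Spos L M ω z σ - SposInf n z σ‖ := hmul z _ _
      _ ≤ ε := h

/-- **Position-space data ⇒ `FinalTwoLegVolLimit β U μ K Mstar`.**  The instance `S = klSelfEnergy L M β U μ K klE0 (nScales β + 1)`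
(the two-leg vertex function of the fully integrated countertermed action) of `volLimit_of_siteKernel`: a site representation against
bounded continuous characters, a summable decay majorant uniform in `(L, M, ω)`, and per-site limits at every Matsubara integer give
the volume-limit slot of the frame `K`. -/
theorem finalTwoLegVolLimit_of_siteKernel {β U μ : ℝ} {K : TrigPolyC4v} {Mstar : ℕ → ℕ}
    {χ : Site 2 → (Fin 2 → ℝ) → ℂ} (hχc : ∀ z, Continuous (χ z)) (hχ1 : ∀ z p, ‖χ z p‖ ≤ 1)
    {Spos : ∀ (L M : ℕ) [NeZero L] [NeZero M], MatsubaraIdx M → Site 2 → Fin 2 → ℂ}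
    {SposInf : ℤ → Site 2 → Fin 2 → ℂ} {m : Site 2 → ℝ} (hm : Summable m) {L₀ : ℕ}
    (hrepr : ∀ (L : ℕ) [NeZero L], L₀ ≤ L → ∀ (M : ℕ) [NeZero M], Mstar L ≤ M →
      ∀ (ω : MatsubaraIdx M) (k : TorusSite 2 L) (σ : Fin 2),
        HasSum (fun z => χ z (latticeMomentum L k) * Spos L M ω z σ)
          (klSelfEnergy L M β U μ K klE0 (nScales β + 1) (ω, k) σ))
    (hmaj : ∀ (z : Site 2) (L : ℕ) [NeZero L], L₀ ≤ L → ∀ (M : ℕ) [NeZero M], Mstar L ≤ M →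
      ∀ (ω : MatsubaraIdx M) (σ : Fin 2), ‖Spos L M ω z σ‖ ≤ m z)
    (hlim : ∀ (n : ℤ) (σ : Fin 2) (z : Site 2) (ε : ℝ), 0 < ε → ∃ L₁ : ℕ, ∀ (L : ℕ) [NeZero L], L₁ ≤ L →
      ∃ M₁ : ℕ, ∀ (M : ℕ) [NeZero M], M₁ ≤ M → ∀ ω : MatsubaraIdx M, matsubaraInt M ω = n →
        ‖Spos L M ω z σ - SposInf n z σ‖ ≤ ε) :
    FinalTwoLegVolLimit β U μ K Mstar :=
  volLimit_of_siteKernel (S := fun L M _ _ k σ => klSelfEnergy L M β U μ K klE0 (nScales β + 1) k σ)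
    hχc hχ1 hm hrepr hmaj hlim

/-! ## §3 Frequency-dependent decay majorants -/

/-- **(a′) + (b) ⇒ the site limits obey the scale-`n` majorant** (`m n z` may depend on the Matsubara integer `n = matsubaraInt M ω`). -/
theorem norm_siteLimit_le_freq
    {Spos : ∀ (L M : ℕ) [NeZero L] [NeZero M], MatsubaraIdx M → Site 2 → Fin 2 → ℂ}
    {SposInf : ℤ → Site 2 → Fin 2 → ℂ} {m : ℤ → Site 2 → ℝ} {Mstar : ℕ → ℕ} {L₀ : ℕ}
    (hmaj : ∀ (z : Site 2) (L : ℕ) [NeZero L], L₀ ≤ L → ∀ (M : ℕ) [NeZero M], Mstar L ≤ M →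
      ∀ (ω : MatsubaraIdx M) (σ : Fin 2), ‖Spos L M ω z σ‖ ≤ m (matsubaraInt M ω) z)
    (hlim : ∀ (n : ℤ) (σ : Fin 2) (z : Site 2) (ε : ℝ), 0 < ε → ∃ L₁ : ℕ, ∀ (L : ℕ) [NeZero L], L₁ ≤ L →
      ∃ M₁ : ℕ, ∀ (M : ℕ) [NeZero M], M₁ ≤ M → ∀ ω : MatsubaraIdx M, matsubaraInt M ω = n →
        ‖Spos L M ω z σ - SposInf n z σ‖ ≤ ε)
    (n : ℤ) (z : Site 2) (σ : Fin 2) : ‖SposInf n z σ‖ ≤ m n z := by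
  refine le_of_forall_pos_le_add fun ε hε => ?_
  obtain ⟨L₁, hL₁⟩ := hlim n σ z ε hε
  set L : ℕ := max (max L₀ L₁) 1 with hL
  haveI : NeZero L := ⟨by omega⟩
  have hL0 : L₀ ≤ L := (le_max_left _ _).trans (le_max_left _ _)
  have hL1 : L₁ ≤ L := (le_max_right _ _).trans (le_max_left _ _)
  obtain ⟨M₁, hM₁⟩ := hL₁ L hL1
  set M : ℕ := max (max (Mstar L) M₁) (n.natAbs + 1) with hM
  haveI : NeZero M := ⟨by omega⟩
  have hMs : Mstar L ≤ M := (le_max_left _ _).trans (le_max_left _ _)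
  have hM1 : M₁ ≤ M := (le_max_right _ _).trans (le_max_left _ _)
  have hMn : n.natAbs + 1 ≤ M := le_max_right _ _
  have hn : -(M : ℤ) ≤ n ∧ n < M := by omega
  set ω : MatsubaraIdx M := idxOfInt M n hn
  have hω : matsubaraInt M ω = n := matsubaraInt_idxOfInt M n hn
  have h1 : ‖Spos L M ω z σ‖ ≤ m n z := by
    have h := hmaj z L hL0 M hMs ω σ
    rwa [hω] at h
  have h2 : ‖Spos L M ω z σ - SposInf n z σ‖ ≤ ε := hM₁ M hM1 ω hω
  calc ‖SposInf n z σ‖ = ‖Spos L M ω z σ - (Spos L M ω z σ - SposInf n z σ)‖ := by rw [sub_sub_cancel]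
    _ ≤ ‖Spos L M ω z σ‖ + ‖Spos L M ω z σ - SposInf n z σ‖ := norm_sub_le _ _
    _ ≤ m n z + ε := add_le_add h1 h2

/-- **Position-space data with frequency-dependent decay majorants ⇒ the volume-limit text (abstract form)**: as
`volLimit_of_siteKernel`, but the decay majorant `m n z` may depend on the external Matsubara integer `n = matsubaraInt M ω`, with
`Σ'_z m n z ≤ B` for every `n`. -/
theorem volLimit_of_siteKernel_freq
    {S : ∀ (L M : ℕ) [NeZero L] [NeZero M], FreqMomentum L M → Fin 2 → ℂ} {Mstar : ℕ → ℕ}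
    {χ : Site 2 → (Fin 2 → ℝ) → ℂ} (hχc : ∀ z, Continuous (χ z)) (hχ1 : ∀ z p, ‖χ z p‖ ≤ 1)
    {Spos : ∀ (L M : ℕ) [NeZero L] [NeZero M], MatsubaraIdx M → Site 2 → Fin 2 → ℂ}
    {SposInf : ℤ → Site 2 → Fin 2 → ℂ} {m : ℤ → Site 2 → ℝ} (hm : ∀ n : ℤ, Summable (m n)) {B : ℝ}
    (hB : ∀ n : ℤ, ∑' z, m n z ≤ B) {L₀ : ℕ}
    (hrepr : ∀ (L : ℕ) [NeZero L], L₀ ≤ L → ∀ (M : ℕ) [NeZero M], Mstar L ≤ M →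
      ∀ (ω : MatsubaraIdx M) (k : TorusSite 2 L) (σ : Fin 2),
        HasSum (fun z => χ z (latticeMomentum L k) * Spos L M ω z σ) (S L M (ω, k) σ))
    (hmaj : ∀ (z : Site 2) (L : ℕ) [NeZero L], L₀ ≤ L → ∀ (M : ℕ) [NeZero M], Mstar L ≤ M →
      ∀ (ω : MatsubaraIdx M) (σ : Fin 2), ‖Spos L M ω z σ‖ ≤ m (matsubaraInt M ω) z)
    (hlim : ∀ (n : ℤ) (σ : Fin 2) (z : Site 2) (ε : ℝ), 0 < ε → ∃ L₁ : ℕ, ∀ (L : ℕ) [NeZero L], L₁ ≤ L →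
      ∃ M₁ : ℕ, ∀ (M : ℕ) [NeZero M], M₁ ≤ M → ∀ ω : MatsubaraIdx M, matsubaraInt M ω = n →
        ‖Spos L M ω z σ - SposInf n z σ‖ ≤ ε) :
    ∃ sigmaInf : ℤ → (Fin 2 → ℝ) → Fin 2 → ℂ, ∃ B : ℝ, ∃ L₀' : ℕ,
      (∀ (n : ℤ) (σ : Fin 2), Continuous fun p : Fin 2 → ℝ => sigmaInf n p σ) ∧
      (∀ (L : ℕ) [NeZero L], L₀' ≤ L → ∀ (M : ℕ) [NeZero M], Mstar L ≤ M →
        ∀ (k : FreqMomentum L M) (σ : Fin 2), ‖S L M k σ‖ ≤ B) ∧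
      (∀ (n : ℤ) (σ : Fin 2) (ε : ℝ), 0 < ε → ∃ L₁ : ℕ, ∀ (L : ℕ) [NeZero L], L₁ ≤ L →
        ∃ M₁ : ℕ, ∀ (M : ℕ) [NeZero M], M₁ ≤ M → ∀ ω : MatsubaraIdx M, matsubaraInt M ω = n →
          ∀ k : TorusSite 2 L, ‖S L M (ω, k) σ - sigmaInf n (latticeMomentum L k) σ‖ ≤ ε) := by
  have hbddInf : ∀ (n : ℤ) (z : Site 2) (σ : Fin 2), ‖SposInf n z σ‖ ≤ m n z :=
    norm_siteLimit_le_freq (Mstar := Mstar) hmaj hlim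
  have hmul : ∀ (z : Site 2) (p : Fin 2 → ℝ) (a : ℂ), ‖χ z p * a‖ ≤ ‖a‖ := fun z p a => by
    rw [norm_mul]
    exact (mul_le_of_le_one_left (norm_nonneg a) (hχ1 z p))
  refine volLimit_of_termwise_freq (S := S) (Mstar := Mstar) (ι := Site 2)
    (v := fun z L M _ _ k σ => χ z (latticeMomentum L k.2) * Spos L M k.1 z σ)
    (vInf := fun z n p σ => χ z p * SposInf n z σ) (m := m) hm hB (L₀ := L₀) ?_ ?_ ?_ ?_ ?_
  · intro L _ hL M _ hM k σ
    obtain ⟨ω, kk⟩ := k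
    exact hrepr L hL M hM ω kk σ
  · intro z L _ hL M _ hM ω k σ
    exact (hmul z _ _).trans (hmaj z L hL M hM ω σ)
  · intro z n σ
    exact (hχc z).mul continuous_const
  · intro z n p σ
    exact (hmul z p _).trans (hbddInf n z σ)
  · intro z n σ ε hε
    obtain ⟨L₁, hL₁⟩ := hlim n σ z ε hε
    refine ⟨L₁, fun L _ hL => ?_⟩
    obtain ⟨M₁, hM₁⟩ := hL₁ L hL
    refine ⟨M₁, fun M _ hM ω hω k => ?_⟩
    have h := hM₁ M hM ω hω
    calc ‖χ z (latticeMomentum L k) * Spos L M ω z σ - χ z (latticeMomentum L k) * SposInf n z σ‖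
        = ‖χ z (latticeMomentum L k) * (Spos L M ω z σ - SposInf n z σ)‖ := by rw [mul_sub]
      _ ≤ ‖Spos L M ω z σ - SposInf n z σ‖ := hmul z _ _
      _ ≤ ε := h

/-- **Position-space data with frequency-dependent decay majorants ⇒ `FinalTwoLegVolLimit β U μ K Mstar`**: the instance
`S = klSelfEnergy … (nScales β + 1)` of `volLimit_of_siteKernel_freq`. -/
theorem finalTwoLegVolLimit_of_siteKernel_freq {β U μ : ℝ} {K : TrigPolyC4v} {Mstar : ℕ → ℕ}
    {χ : Site 2 → (Fin 2 → ℝ) → ℂ} (hχc : ∀ z, Continuous (χ z)) (hχ1 : ∀ z p, ‖χ z p‖ ≤ 1)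
    {Spos : ∀ (L M : ℕ) [NeZero L] [NeZero M], MatsubaraIdx M → Site 2 → Fin 2 → ℂ}
    {SposInf : ℤ → Site 2 → Fin 2 → ℂ} {m : ℤ → Site 2 → ℝ} (hm : ∀ n : ℤ, Summable (m n)) {B : ℝ}
    (hB : ∀ n : ℤ, ∑' z, m n z ≤ B) {L₀ : ℕ}
    (hrepr : ∀ (L : ℕ) [NeZero L], L₀ ≤ L → ∀ (M : ℕ) [NeZero M], Mstar L ≤ M →
      ∀ (ω : MatsubaraIdx M) (k : TorusSite 2 L) (σ : Fin 2),
        HasSum (fun z => χ z (latticeMomentum L k) * Spos L M ω z σ)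
          (klSelfEnergy L M β U μ K klE0 (nScales β + 1) (ω, k) σ))
    (hmaj : ∀ (z : Site 2) (L : ℕ) [NeZero L], L₀ ≤ L → ∀ (M : ℕ) [NeZero M], Mstar L ≤ M →
      ∀ (ω : MatsubaraIdx M) (σ : Fin 2), ‖Spos L M ω z σ‖ ≤ m (matsubaraInt M ω) z)
    (hlim : ∀ (n : ℤ) (σ : Fin 2) (z : Site 2) (ε : ℝ), 0 < ε → ∃ L₁ : ℕ, ∀ (L : ℕ) [NeZero L], L₁ ≤ L →
      ∃ M₁ : ℕ, ∀ (M : ℕ) [NeZero M], M₁ ≤ M → ∀ ω : MatsubaraIdx M, matsubaraInt M ω = n →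
        ‖Spos L M ω z σ - SposInf n z σ‖ ≤ ε) :
    FinalTwoLegVolLimit β U μ K Mstar :=
  volLimit_of_siteKernel_freq (S := fun L M _ _ k σ => klSelfEnergy L M β U μ K klE0 (nScales β + 1) k σ)
    hχc hχ1 hm hB hrepr hmaj hlim

/-! ## §4 The standard characters `e^{∓ip·z}` -/

/-- The plane-wave character `p ↦ e^{iη p·z}` (`η = ∓1`, or any real `η`) is continuous in the momentum. -/
theorem continuous_planeWaveChar (η : ℝ) (z : Site 2) :
    Continuous fun p : Fin 2 → ℝ => Complex.exp (Complex.I * ((η * ∑ i, p i * (z i : ℝ) : ℝ) : ℂ)) := by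
  have h1 : Continuous fun p : Fin 2 → ℝ => ((η * ∑ i, p i * (z i : ℝ) : ℝ) : ℂ) :=
    Complex.continuous_ofReal.comp (by fun_prop)
  exact Complex.continuous_exp.comp (continuous_const.mul h1)

/-- The plane-wave character has modulus `1` (so `≤ 1`). -/
theorem norm_planeWaveChar_le_one (η : ℝ) (z : Site 2) (p : Fin 2 → ℝ) :
    ‖Complex.exp (Complex.I * ((η * ∑ i, p i * (z i : ℝ) : ℝ) : ℂ))‖ ≤ 1 := by
  rw [mul_comm, Complex.norm_exp_ofReal_mul_I]

end Summit.HubbardSuperconductivity.HubbardSuperconductivity.Theorems.KLRegimeSplit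

end
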